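import Summits.AtomisticToContinuum.HydrodynamicLimit.Theorems.AntiMazurCoboundariesCellForecastPressureDecayClusterTailNonFresh
import Summits.AtomisticToContinuum.HydrodynamicLimit.Theorems.AntiMazurCoboundariesCellForecastPressureDecayClusterTailFreshPairHit
import Summits.AtomisticToContinuum.HydrodynamicLimit.Theorems.AntiMazurCoboundariesCellForecastPressureDecayClusterTailDoubleCylinder
import Summits.AtomisticToContinuum.HydrodynamicLimit.Theorems.AntiMazurCoboundariesCellForecastPressureDecayClusterTailAssembly
import HarnessLib

/-!
# S2e · the short-time cluster tail of the canonical hard-sphere cell law (registered stub `stub_clusterTail`,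
# crux line `enskog-compensator-martingale`, crux `CellForecastPressureDecay`, stmt-AtomisticToContinuum-13915)

The closing file of stub S2e of the line (lead `prover-line-stmt-AtomisticToContinuum-13915-c3-0`, 2026-08-17):
`ClusterTail σ` — for `Δ ≤ δ₀`, `L ≥ L₀`, `n ≤ 2L³` and every cluster dynamics, the expected number of spheres of
the slab `(0, Δ]` that are neither free nor in an isolated pair, and the expected number of cylinder pairs that are
not isolated, are both `≤ C (L³Δ² + L²Δ)` — a Lanford-type SHORT-TIME estimate at FIXED diameter `σ ≤ 3/16` for the
free-boundary canonical cell, proved WITHOUT a cluster/BBGKY expansion from four registered sub-goals landed by the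
lead's wave 1:

* `stub_clusterTail_nonFresh` (T2, p133822): a sphere free on `(0,s)` whose first contact at `s ≤ Δ` is with a sphere
  that already collided is a second-order event — insertion (`lintegral_cellLaw_succ_le`) + removal + cylinder charging
  at a grid time + the energy identity `∑_{j ∈ NF} ‖V_j(t)‖² = ∑_{j ∈ NF} ‖v_j‖²` on the collision-closed set `NF` of
  non-free spheres, which reduces the bath speeds to the weighted first-order bound `stub_clusterTail_firstOrder`
  (p130629);
* `stub_clusterTail_freshPairHit` (T1, p134519): a fresh colliding pair disturbed by a third sphere within the slab —
  double insertion, pair removal until the first outsider contact, charging, translation of the pair, bath energy;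
* `stub_clusterTail_doubleCylinder` (S3, p128654): two collision cylinders at one sphere — static (Ruelle's 3-label
  bound, independence of velocities, cylinder volume `π σ² Δ ‖u‖`);
* `stub_clusterTail_assembly` (p132645): the pathwise combinatorics on the good set reducing (a), (b) of `ClusterTail`
  to these three counts.

References: O. E. Lanford III, *Time evolution of large classical systems* (1975), §§ 5–6 (short-time collision-history
estimates); Cercignani–Illner–Pulvirenti 1994 §§ 2.2, 4.4; Gallagher–Saint-Raymond–Texier 2013 Part II (pseudo-trajectories).
-/

noncomputable section

namespace Summit.AtomisticToContinuum.HydrodynamicLimit.Theorems.EnskogCompensator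

/-- **S2e · the short-time cluster tail** (registered stub `stub_clusterTail` of the line
`enskog-compensator-martingale`): for `0 < σ ≤ 3/16` the canonical cell law has the cluster tail `ClusterTail σ`.
The hypothesis `ContactLayerBounds σ` of the registered signature is not needed (the static input is Ruelle's bound
inside `stub_clusterTail_doubleCylinder`). [cite: Lanford1975, §§5–6] -/
theorem stub_clusterTail :
    ∀ σ : ℝ, 0 < σ → σ ≤ 3 / 16 → CellLawFactorises σ → ContactLayerBounds σ → ClusterTail σ :=
  fun σ hσ hσ' hfac _ =>
    stub_clusterTail_assembly σ hσ hσ' (stub_clusterTail_nonFresh σ hσ hσ' hfac)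
      (stub_clusterTail_freshPairHit σ hσ hσ' hfac) (stub_clusterTail_doubleCylinder σ hσ hσ' hfac)

/-- **The cluster tail, unconditionally**: `ClusterTail σ` for every `0 < σ ≤ 3/16` (the cell law always
factorises, `stub_cellLawFactorises`). [cite: Lanford1975, §§5–6] -/
theorem clusterTail_holds {σ : ℝ} (hσ : 0 < σ) (hσ' : σ ≤ 3 / 16) : ClusterTail σ :=
  stub_clusterTail_assembly σ hσ hσ' (stub_clusterTail_nonFresh σ hσ hσ' (stub_cellLawFactorises σ))
    (stub_clusterTail_freshPairHit σ hσ hσ' (stub_cellLawFactorises σ))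
    (stub_clusterTail_doubleCylinder σ hσ hσ' (stub_cellLawFactorises σ))

end Summit.AtomisticToContinuum.HydrodynamicLimit.Theorems.EnskogCompensator

end
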